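import Summits.CriticalPhenomena.CardyFormulaZ2.Theorems.HalfPlaneMarkDensityLaw.Negative.MarkEvents
import Literature.Probability.Percolation.Z2HalfPlaneThreeArm
import Literature.Probability.Percolation.FiniteEnergy

/-!
# Self-duality of the half-plane arc-crossing function of bond-`ℤ²`: inserting a leg costs `1/2`

Support file for the crux `HalfPlaneMarkDensityLaw` (stmt-CriticalPhenomena-5661), line `Sketch`,
Stage II of the self-duality programme ("few boundary touches ⇒ three-arm event").  The library's
half-plane three-arm event `Z2HalfPlane.threeArm` requires an OPEN LEG `leg a ∈ ω` docking the open
arm, while the events `E` of the programme (built from open paths of the lattice half-plane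
`H = {x₁ ≥ 0}`) are determined by the edges `Z2HalfPlane.hpEdges` of `H`, and the docking abscissa
`τ(ω)` is read off the same edges.  The legs are independent fair coins outside `hpEdges`, so
inserting the leg at the (configuration-dependent) abscissa `τ(ω)` costs exactly a factor `1/2`:
`P_{1/2}(E ∩ {leg (τ ω) ∈ ω}) = P_{1/2}(E) / 2` (`leg_factor_half`).

The proof is the conditional-independence decomposition of `FiniteEnergy.lean` along the values
of the countably-valued statistic `τ` (`bondPercolation_real_inter_memDep_ge/le` with
`q = q' = 1/2`): `E ∩ {τ = k}` is determined by `hpEdges`, the one-edge cylinder `{leg k ∈ ω}` by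
`{leg k}`, the two edge sets are disjoint (the lower endpoint `(k,-1)` of `leg k` has height `-1`),
and `P_{1/2}(leg k ∈ ω) = 1/2` (`bondPercolation_cylinder`, `Z2HalfPlane.adj_leg`).
-/

noncomputable section

namespace Summit.CriticalPhenomena.CardyFormulaZ2.Cruxes.HalfPlaneMarkDensityLaw.SketchLine.SelfDual

open Literature.Probability.Percolation Literature.Probability.LatticeModels
open Literature.Probability.Percolation.Z2HalfPlane (leg adj_leg)
open MeasureTheory Filter Set SimpleGraph
open Summit.CriticalPhenomena.CardyFormulaZ2.Theorems.HalfPlaneMarkDensityLaw.Negative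

/-- The one-edge cylinder `{ω | e ∈ ω}` is determined by the single edge `e`. [folklore] -/
theorem determinedBy_setOf_mem_singleton (e : Sym2 (Site 2)) :
    DeterminedBy {ω : BondConfig (Site 2) | e ∈ ω} ({e} : Set (Sym2 (Site 2))) := by
  rw [determinedBy_iff]
  intro ω ω' h
  simp only [mem_setOf_eq]
  exact ⟨fun he => ((Set.ext_iff.1 h e).1 ⟨he, rfl⟩).1, fun he => ((Set.ext_iff.1 h e).2 ⟨he, rfl⟩).1⟩

/-- A leg is not an edge of the half-plane: its lower endpoint `(k,-1)` has height `-1`. [folklore] -/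
theorem leg_notMem_hpEdges (k : ℤ) : leg k ∉ Z2HalfPlane.hpEdges := by
  intro h
  have h1 : (0 : ℤ) ≤ (![k, -1] : Site 2) 1 := h ![k, -1] (Sym2.mem_mk_left _ _)
  simp at h1

/-- The half-plane edges and (the singleton of) a leg are disjoint edge sets. [folklore] -/
theorem disjoint_hpEdges_leg (k : ℤ) : Disjoint Z2HalfPlane.hpEdges ({leg k} : Set (Sym2 (Site 2))) :=
  Set.disjoint_singleton_right.2 (leg_notMem_hpEdges k)

/-- Under `P_{1/2}` each leg is open with probability exactly `1/2` (one-edge marginal of the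
product measure; the leg is a lattice edge, `Z2HalfPlane.adj_leg`). [folklore] -/
theorem real_setOf_leg_mem (k : ℤ) : μ.real {ω : BondConfig (Site 2) | leg k ∈ ω} = 1 / 2 := by
  unfold μ
  rw [bondPercolation_cylinder (zdGraph 2) half (e := leg k) ((zdGraph 2).mem_edgeSet.2 (adj_leg k)),
    coe_half]

/-- **Inserting the leg at a boundary-determined abscissa costs exactly a factor `1/2`.**  Let `E`
be a measurable event determined by the half-plane edges `hpEdges`, and `τ` an integer statistic
with values in the finite set `F` whose level sets are measurable and determined by `hpEdges`.
Then `P_{1/2}(E ∩ {ω | leg (τ ω) ∈ ω}) = P_{1/2}(E) / 2`: conditionally on `E ∩ {τ = k}` the leg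
`leg k ∉ hpEdges` is still a fair coin (`bondPercolation_real_inter_memDep_ge/le`). [folklore] -/
theorem leg_factor_half : ∀ (E : Set (BondConfig (Site 2))) (τ : BondConfig (Site 2) → ℤ) (F : Finset ℤ), MeasurableSet E → DeterminedBy E Z2HalfPlane.hpEdges → (∀ ω, τ ω ∈ F) → (∀ k : ℤ, MeasurableSet {ω : BondConfig (Site 2) | τ ω = k}) → (∀ k : ℤ, DeterminedBy {ω : BondConfig (Site 2) | τ ω = k} Z2HalfPlane.hpEdges) → μ.real (E ∩ {ω | leg (τ ω) ∈ ω}) = μ.real E / 2 := by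
  intro E τ F hEm hE _hF hτm hτ
  have hdet : ∀ b : ℤ, DeterminedBy (E ∩ τ ⁻¹' {b}) Z2HalfPlane.hpEdges := fun b => hE.inter (hτ b)
  have hmeas : ∀ b : ℤ, MeasurableSet (E ∩ τ ⁻¹' {b}) := fun b => hEm.inter (hτm b)
  have hge := bondPercolation_real_inter_memDep_ge (zdGraph 2) half (A := E)
    (fun _ => Z2HalfPlane.hpEdges) (fun b => ({leg b} : Set (Sym2 (Site 2)))) τ
    (fun b => {ω : BondConfig (Site 2) | leg b ∈ ω}) hdet hmeas
    (fun b => determinedBy_setOf_mem_singleton (leg b)) (fun b => measurableSet_mem (leg b))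
    (fun ω _ => disjoint_hpEdges_leg (τ ω)) (q := 1 / 2) (by norm_num)
    (fun ω _ => (real_setOf_leg_mem (τ ω)).ge)
  have hle := bondPercolation_real_inter_memDep_le (zdGraph 2) half (A := E)
    (fun _ => Z2HalfPlane.hpEdges) (fun b => ({leg b} : Set (Sym2 (Site 2)))) τ
    (fun b => {ω : BondConfig (Site 2) | leg b ∈ ω}) hdet hmeas
    (fun b => determinedBy_setOf_mem_singleton (leg b)) (fun b => measurableSet_mem (leg b))
    (fun ω _ => disjoint_hpEdges_leg (τ ω)) (q := 1 / 2)
    (fun ω _ => (real_setOf_leg_mem (τ ω)).le)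
  have key : μ.real (E ∩ {ω | leg (τ ω) ∈ ω}) = 1 / 2 * μ.real E := le_antisymm hle hge
  rw [key]
  ring

end Summit.CriticalPhenomena.CardyFormulaZ2.Cruxes.HalfPlaneMarkDensityLaw.SketchLine.SelfDual

end
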